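import Mathlib
import HarnessLib
import Literature.Geometry.DiscreteGeometry.SphericalCodeHullEulerFormula
import Summits.AtomisticToContinuum.Crystallization.Theorems.PricedLinkCensusSoftFourRingsHullBridge
import Summits.AtomisticToContinuum.Crystallization.Theorems.PricedLinkCensusSoftFourRingsInterior
import Summits.AtomisticToContinuum.Crystallization.Theorems.PricedLinkCensusSoftFourRingsBondFacet
import Summits.AtomisticToContinuum.Crystallization.Theorems.PricedLinkCensusSoftFourRingsFanGap

/-!
# Soft four-rings: a three-fan vertex carries an extra hull edge

Support file for `SoftFourRings` (route `PricedLinkCensus`, sub-problem `Crystallization`).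

Combinatorics of the hull complex of the twelve unit directions (`hullEdges`, `facetNormals`,
`facetsOfEdge` of `Literature.Geometry.DiscreteGeometry`):

* `exists_facet_ne_of_mem_hullEdges` — through a hull edge there is a facet different from any
  given one (every hull edge lies in exactly two facets);
* `exists_consecutive_neighbour` — inside a facet through the hull edge `{v, u}` the vertex `v` has
  a second facet-neighbour `y ≠ u` with `{v, y}` again a hull edge;
* `exists_extra_hullEdge_of_three_fan_one_percent` — **rule R1** of the classification: if `v` is
  bonded to `w 0, …, w 3` and `w 0 ∼ w 1 ∼ w 2 ∼ w 3` are bonded (three bond triangles at `v`),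
  then `v` has a hull edge to a point `y ∉ {v, w 0, …, w 3}` (conditional on Tammes-13, through the
  corner cap `no_facet_through_three_fan_one_percent`).
-/

namespace Summit.AtomisticToContinuum.Crystallization.Theorems

open Real RealInnerProductSpace Literature.Geometry.DiscreteGeometry

/-- `(i + 1) % m ≠ i` for `i < m`, `2 ≤ m`. -/
theorem succ_mod_ne {m i : ℕ} (hm : 2 ≤ m) (hi : i < m) : (i + 1) % m ≠ i := by
  rcases Nat.lt_or_ge (i + 1) m with h | h
  · rw [Nat.mod_eq_of_lt h]; omega
  · have : i + 1 = m := by omega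
    rw [this, Nat.mod_self]; omega

/-- `((j + 1) % m + 1) % m ≠ j` for `j < m`, `3 ≤ m`. -/
theorem succ_succ_mod_ne {m j : ℕ} (hm : 3 ≤ m) (hj : j < m) : ((j + 1) % m + 1) % m ≠ j := by
  rcases Nat.lt_or_ge (j + 1) m with h | h
  · rw [Nat.mod_eq_of_lt h]
    rcases Nat.lt_or_ge (j + 1 + 1) m with h' | h'
    · rw [Nat.mod_eq_of_lt h']; omega
    · have : j + 1 + 1 = m := by omega
      rw [this, Nat.mod_self]; omega
  · have : j + 1 = m := by omega
    rw [this, Nat.mod_self]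
    rw [Nat.mod_eq_of_lt (by omega : 1 < m)]; omega

/-- `(j + m - 1) % m ≠ j` for `j < m`, `2 ≤ m`. -/
theorem pred_mod_ne {m j : ℕ} (hm : 2 ≤ m) (hj : j < m) : (j + m - 1) % m ≠ j := by
  rcases Nat.eq_zero_or_pos j with rfl | hpos
  · rw [Nat.zero_add, Nat.mod_eq_of_lt (by omega : m - 1 < m)]; omega
  · have : j + m - 1 = (j - 1) + m := by omega
    rw [this, Nat.add_mod_right, Nat.mod_eq_of_lt (by omega : j - 1 < m)]; omega

/-- `(j + m - 1) % m ≠ (j + 1) % m` for `j < m`, `3 ≤ m`. -/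
theorem pred_mod_ne_succ_mod {m j : ℕ} (hm : 3 ≤ m) (hj : j < m) :
    (j + m - 1) % m ≠ (j + 1) % m := by
  have h1 : (j + m - 1) % m = if j = 0 then m - 1 else j - 1 := by
    split_ifs with h
    · subst h; rw [Nat.zero_add, Nat.mod_eq_of_lt (by omega : m - 1 < m)]
    · have : j + m - 1 = (j - 1) + m := by omega
      rw [this, Nat.add_mod_right, Nat.mod_eq_of_lt (by omega : j - 1 < m)]
  have h2 : (j + 1) % m = if j + 1 = m then 0 else j + 1 := by
    split_ifs with h
    · rw [h, Nat.mod_self]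
    · exact Nat.mod_eq_of_lt (by omega)
  rw [h1, h2]
  split_ifs <;> omega

/-- **Through a hull edge there is a second facet**: for every facet normal `c₀` there is a facet
normal `c' ≠ c₀` whose tight set contains the hull edge `T`. -/
theorem exists_facet_ne_of_mem_hullEdges {X : Finset (EuclideanSpace ℝ (Fin 3))} (hX1 : ∀ y ∈ X, ‖y‖ = 1)
    (h0 : (0 : (EuclideanSpace ℝ (Fin 3))) ∈ interior (convexHull ℝ (X : Set (EuclideanSpace ℝ (Fin 3))))) {T : Finset (EuclideanSpace ℝ (Fin 3))}
    (hT : T ∈ hullEdges X) (c₀ : (EuclideanSpace ℝ (Fin 3))) :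
    ∃ c' ∈ facetNormals X, c' ≠ c₀ ∧ T ⊆ tightSet X c' := by
  classical
  have hcard : 1 < (facetsOfEdge X T).card := by
    rw [card_facetsOfEdge hX1 h0 hT]; norm_num
  obtain ⟨c', hc', hne⟩ := Finset.exists_mem_ne hcard c₀
  unfold facetsOfEdge at hc'
  rw [Finset.mem_filter] at hc'
  exact ⟨c', hc'.1, hne, hc'.2⟩

/-- **Three facets through one hull edge are impossible.** -/
theorem false_of_three_facetsOfEdge {X : Finset (EuclideanSpace ℝ (Fin 3))} (hX1 : ∀ y ∈ X, ‖y‖ = 1)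
    (h0 : (0 : (EuclideanSpace ℝ (Fin 3))) ∈ interior (convexHull ℝ (X : Set (EuclideanSpace ℝ (Fin 3))))) {T : Finset (EuclideanSpace ℝ (Fin 3))}
    (hT : T ∈ hullEdges X) {c₁ c₂ c₃ : (EuclideanSpace ℝ (Fin 3))} (hc₁ : c₁ ∈ facetNormals X)
    (hc₂ : c₂ ∈ facetNormals X) (hc₃ : c₃ ∈ facetNormals X) (hT₁ : T ⊆ tightSet X c₁)
    (hT₂ : T ⊆ tightSet X c₂) (hT₃ : T ⊆ tightSet X c₃) (h12 : c₁ ≠ c₂) (h13 : c₁ ≠ c₃)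
    (h23 : c₂ ≠ c₃) : False := by
  classical
  have hsub : ({c₁, c₂, c₃} : Finset (EuclideanSpace ℝ (Fin 3))) ⊆ facetsOfEdge X T := by
    intro c hc
    unfold facetsOfEdge
    rw [Finset.mem_filter]
    rw [Finset.mem_insert, Finset.mem_insert, Finset.mem_singleton] at hc
    rcases hc with rfl | rfl | rfl
    exacts [⟨hc₁, hT₁⟩, ⟨hc₂, hT₂⟩, ⟨hc₃, hT₃⟩]
  have h3 : ({c₁, c₂, c₃} : Finset (EuclideanSpace ℝ (Fin 3))).card = 3 := Finset.card_eq_three.2 ⟨c₁, c₂, c₃, h12, h13, h23, rfl⟩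
  have := Finset.card_le_card hsub
  rw [h3, card_facetsOfEdge hX1 h0 hT] at this
  omega

/-- **The other facet-neighbour.** If the hull edge `{v, u}` lies in the facet of `c`, then `v`
has a second neighbour `y` along that facet: `y` is tight, `y ≠ v`, `y ≠ u`, and `{v, y}` is a
hull edge. -/
theorem exists_consecutive_neighbour {X : Finset (EuclideanSpace ℝ (Fin 3))} (hX1 : ∀ y ∈ X, ‖y‖ = 1)
    (h0 : (0 : (EuclideanSpace ℝ (Fin 3))) ∈ interior (convexHull ℝ (X : Set (EuclideanSpace ℝ (Fin 3))))) {c : (EuclideanSpace ℝ (Fin 3))} (hcF : c ∈ facetNormals X)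
    {v u : (EuclideanSpace ℝ (Fin 3))} (hvu : v ≠ u) (hT : ({v, u} : Finset (EuclideanSpace ℝ (Fin 3))) ∈ hullEdges X)
    (hTc : ({v, u} : Finset (EuclideanSpace ℝ (Fin 3))) ⊆ tightSet X c) :
    ∃ y ∈ tightSet X c, y ≠ v ∧ y ≠ u ∧ ({v, y} : Finset (EuclideanSpace ℝ (Fin 3))) ∈ hullEdges X := by
  classical
  set hc := ne_zero_of_mem_facetNormals hX1 hcF
  set m := (facetAngles X c hc).card with hm
  set W := facetVertex X c hc with hW
  have hm3 : 3 ≤ m := by rw [hm, card_facetAngles hX1 hc]; exact three_le_card_tightSet hcF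
  have hinj : ∀ i j, i < m → j < m → W i = W j → i = j := fun i j hi hj h =>
    facetVertex_injOn hc (Finset.mem_coe.2 (Finset.mem_range.2 hi))
      (Finset.mem_coe.2 (Finset.mem_range.2 hj)) h
  obtain ⟨j, hj, hpair⟩ := consecutive_of_mem_hullEdges hX1 h0 hcF hT hTc
  have hj1 : (j + 1) % m < m := Nat.mod_lt _ (by omega)
  -- `v` is one of the two consecutive vertices
  have hv : v ∈ ({W j, W ((j + 1) % m)} : Finset (EuclideanSpace ℝ (Fin 3))) := by
    rw [← hpair]; exact Finset.mem_insert_self _ _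
  have hu : u ∈ ({W j, W ((j + 1) % m)} : Finset (EuclideanSpace ℝ (Fin 3))) := by
    rw [← hpair]; exact Finset.mem_insert_of_mem (Finset.mem_singleton_self _)
  rw [Finset.mem_insert, Finset.mem_singleton] at hv hu
  rcases hv with hv | hv
  · -- `v = W j`, so `u = W (j+1)`; take the predecessor of `j`
    have huj : u = W ((j + 1) % m) := by
      rcases hu with hu | hu
      · exact absurd (hv.trans hu.symm) hvu
      · exact hu
    set i := (j + m - 1) % m with hi
    have him : i < m := Nat.mod_lt _ (by omega)
    have hi1 : (i + 1) % m = j := succ_pred_mod (by omega) hj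
    refine ⟨W i, facetVertex_mem hc him, ?_, ?_, ?_⟩
    · intro h
      rw [hv] at h
      exact pred_mod_ne (by omega) hj (hinj _ _ him hj h)
    · intro h
      rw [huj] at h
      exact pred_mod_ne_succ_mod hm3 hj (hinj _ _ him hj1 h)
    · have h' : ({W i, W ((i + 1) % m)} : Finset (EuclideanSpace ℝ (Fin 3))) ∈ hullEdges X :=
        pair_mem_hullEdges_of_consecutive hX1 hcF him
      rw [hi1, ← hv, Finset.pair_comm] at h'
      exact h'
  · -- `v = W (j+1)`, so `u = W j`; take the successor of `j + 1`
    have huj : u = W j := by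
      rcases hu with hu | hu
      · exact hu
      · exact absurd (hv.trans hu.symm) hvu
    set i := (j + 1) % m with hi
    have hi1m : (i + 1) % m < m := Nat.mod_lt _ (by omega)
    refine ⟨W ((i + 1) % m), facetVertex_mem hc hi1m, ?_, ?_, ?_⟩
    · intro h
      rw [hv] at h
      exact succ_mod_ne (by omega) hj1 (hinj _ _ hi1m hj1 h)
    · intro h
      rw [huj] at h
      exact succ_succ_mod_ne hm3 hj (hinj _ _ hi1m hj h)
    · have h' : ({W i, W ((i + 1) % m)} : Finset (EuclideanSpace ℝ (Fin 3))) ∈ hullEdges X :=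
        pair_mem_hullEdges_of_consecutive hX1 hcF hj1
      rw [← hv] at h'
      exact h'

/-- **Rule R1: a three-fan vertex carries an extra hull edge** (conditional on Tammes-13).
Among `≥ 12` unit vectors with pairwise inner products `≤ 1 − 1/(2·1.01²)`, let `v` be bonded
(`⟪·,·⟫ ≥ 1 − 1.01²/2`) to `w 0, …, w 3` with `w 0 ∼ w 1 ∼ w 2 ∼ w 3` bonded.  Then some hull edge
at `v` ends outside `{v, w 0, …, w 3}`.  Proof: the bond `{v, w 0}` is a hull edge lying in the
bond-triangle facet `{v, w 0, w 1}` and in a second facet `c'`; the other facet-neighbour `y` of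
`v` in `c'` is neither `w 1` nor `w 2` (the hull edges `{v, w 1}`, `{v, w 2}` already lie in two
bond triangles each) nor `w 3` (no facet contains `v, w 0, w 3`, by the corner cap). -/
theorem exists_extra_hullEdge_of_three_fan_one_percent (hT : musinTarasov2012_tammes_thirteen)
    {X : Finset (EuclideanSpace ℝ (Fin 3))} (hX1 : ∀ y ∈ X, ‖y‖ = 1) (hcard : 12 ≤ X.card)
    (hsepX : ∀ u ∈ X, ∀ u' ∈ X, u ≠ u' → ⟪u, u'⟫ ≤ 1 - 1 / (2 * (101 / 100 : ℝ) ^ 2))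
    {v : (EuclideanSpace ℝ (Fin 3))} (hv : v ∈ X) (w : Fin 4 → (EuclideanSpace ℝ (Fin 3))) (hwX : ∀ k, w k ∈ X) (hwinj : Function.Injective w)
    (hwv : ∀ k, w k ≠ v) (hvw : ∀ k, 1 - (101 / 100 : ℝ) ^ 2 / 2 ≤ ⟪v, w k⟫)
    (h01 : 1 - (101 / 100 : ℝ) ^ 2 / 2 ≤ ⟪w 0, w 1⟫)
    (h12 : 1 - (101 / 100 : ℝ) ^ 2 / 2 ≤ ⟪w 1, w 2⟫)
    (h23 : 1 - (101 / 100 : ℝ) ^ 2 / 2 ≤ ⟪w 2, w 3⟫) :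
    ∃ y ∈ X, y ≠ v ∧ (∀ k, y ≠ w k) ∧ ({v, y} : Finset (EuclideanSpace ℝ (Fin 3))) ∈ hullEdges X := by
  classical
  have h0 : (0 : (EuclideanSpace ℝ (Fin 3))) ∈ interior (convexHull ℝ (X : Set (EuclideanSpace ℝ (Fin 3)))) :=
    zero_mem_interior_convexHull_of_twelve_le_card hT hX1 hcard (ca := 1 - 1 / (2 * (101 / 100 : ℝ) ^ 2))
      (by norm_num) hsepX
  have hw01 : w 0 ≠ w 1 := fun h => by simpa using hwinj h
  have hw12 : w 1 ≠ w 2 := fun h => by simpa using hwinj h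
  have hw23 : w 2 ≠ w 3 := fun h => by simpa using hwinj h
  have hw02 : w 0 ≠ w 2 := fun h => by simpa using hwinj h
  have hw13 : w 1 ≠ w 3 := fun h => by simpa using hwinj h
  have hw03 : w 0 ≠ w 3 := fun h => by simpa using hwinj h
  -- the three bond-triangle facets
  obtain ⟨c₀, hc₀F, hc₀T, -, -⟩ := bond_triangle_facet_one_percent hX1 hsepX hv (hwX 0) (hwX 1)
    (hwv 0).symm (hwv 1).symm hw01 (hvw 0) (hvw 1) h01
  obtain ⟨c₁, hc₁F, hc₁T, -, -⟩ := bond_triangle_facet_one_percent hX1 hsepX hv (hwX 1) (hwX 2)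
    (hwv 1).symm (hwv 2).symm hw12 (hvw 1) (hvw 2) h12
  obtain ⟨c₂, hc₂F, hc₂T, -, -⟩ := bond_triangle_facet_one_percent hX1 hsepX hv (hwX 2) (hwX 3)
    (hwv 2).symm (hwv 3).symm hw23 (hvw 2) (hvw 3) h23
  -- membership facts in the explicit tight sets
  have mem3 : ∀ {a b d x : (EuclideanSpace ℝ (Fin 3))}, x ∈ ({a, b, d} : Finset (EuclideanSpace ℝ (Fin 3))) ↔ x = a ∨ x = b ∨ x = d := by
    intro a b d x
    rw [Finset.mem_insert, Finset.mem_insert, Finset.mem_singleton]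
  have hc01 : c₀ ≠ c₁ := by
    intro h
    have : w 0 ∈ tightSet X c₁ := by rw [← h, hc₀T, mem3]; exact Or.inr (Or.inl rfl)
    rw [hc₁T, mem3] at this
    rcases this with h | h | h
    exacts [hwv 0 h, hw01 h, hw02 h]
  have hc12 : c₁ ≠ c₂ := by
    intro h
    have : w 1 ∈ tightSet X c₂ := by rw [← h, hc₁T, mem3]; exact Or.inr (Or.inl rfl)
    rw [hc₂T, mem3] at this
    rcases this with h | h | h
    exacts [hwv 1 h, hw12 h, hw13 h]
  -- the bond `{v, w 0}` is a hull edge, in `c₀` and in a second facet `c'`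
  have hE0 : ({v, w 0} : Finset (EuclideanSpace ℝ (Fin 3))) ∈ hullEdges X :=
    pair_mem_hullEdges_of_soft_bond_one_percent hX1 hsepX hv (hwX 0) (hwv 0).symm (hvw 0)
  obtain ⟨c', hc'F, hc'0, hc'T⟩ := exists_facet_ne_of_mem_hullEdges hX1 h0 hE0 c₀
  have hvc' : v ∈ tightSet X c' := hc'T (Finset.mem_insert_self _ _)
  have hw0c' : w 0 ∈ tightSet X c' := hc'T (Finset.mem_insert_of_mem (Finset.mem_singleton_self _))
  -- `c'` is none of the bond triangles (it contains `w 0` and differs from `c₀`)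
  have hc'1 : c' ≠ c₁ := by
    intro h
    have := hw0c'
    rw [h, hc₁T, mem3] at this
    rcases this with h | h | h
    exacts [hwv 0 h, hw01 h, hw02 h]
  have hc'2 : c' ≠ c₂ := by
    intro h
    have := hw0c'
    rw [h, hc₂T, mem3] at this
    rcases this with h | h | h
    exacts [hwv 0 h, hw02 h, hw03 h]
  -- the other neighbour of `v` along `c'`
  obtain ⟨y, hyc', hyv, hy0, hEy⟩ := exists_consecutive_neighbour hX1 h0 hc'F (hwv 0).symm hE0 hc'T
  have hyX : y ∈ X := tightSet_subset X c' hyc'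
  have hvy : ({v, y} : Finset (EuclideanSpace ℝ (Fin 3))) ⊆ tightSet X c' := by
    intro x hx
    rw [Finset.mem_insert, Finset.mem_singleton] at hx
    rcases hx with rfl | rfl
    exacts [hvc', hyc']
  refine ⟨y, hyX, hyv, ?_, hEy⟩
  intro k
  fin_cases k
  · exact hy0
  · -- `y = w 1`: the hull edge `{v, w 1}` would lie in `c₀`, `c₁` and `c'`
    show y ≠ w 1
    intro h
    rw [h] at hEy hvy
    refine false_of_three_facetsOfEdge hX1 h0 hEy hc₀F hc₁F hc'F ?_ ?_ hvy hc01 hc'0.symm hc'1.symm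
    · rw [hc₀T]; intro x hx
      rw [Finset.mem_insert, Finset.mem_singleton] at hx
      rw [mem3]; rcases hx with rfl | rfl
      exacts [Or.inl rfl, Or.inr (Or.inr rfl)]
    · rw [hc₁T]; intro x hx
      rw [Finset.mem_insert, Finset.mem_singleton] at hx
      rw [mem3]; rcases hx with rfl | rfl
      exacts [Or.inl rfl, Or.inr (Or.inl rfl)]
  · -- `y = w 2`: the hull edge `{v, w 2}` would lie in `c₁`, `c₂` and `c'`
    show y ≠ w 2
    intro h
    rw [h] at hEy hvy
    refine false_of_three_facetsOfEdge hX1 h0 hEy hc₁F hc₂F hc'F ?_ ?_ hvy hc12 hc'1.symm hc'2.symm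
    · rw [hc₁T]; intro x hx
      rw [Finset.mem_insert, Finset.mem_singleton] at hx
      rw [mem3]; rcases hx with rfl | rfl
      exacts [Or.inl rfl, Or.inr (Or.inr rfl)]
    · rw [hc₂T]; intro x hx
      rw [Finset.mem_insert, Finset.mem_singleton] at hx
      rw [mem3]; rcases hx with rfl | rfl
      exacts [Or.inl rfl, Or.inr (Or.inl rfl)]
  · -- `y = w 3`: the facet `c'` would contain `v`, `w 0`, `w 3`
    show y ≠ w 3
    intro h
    rw [h] at hyc'
    exact no_facet_through_three_fan_one_percent hT hX1 hcard hsepX hv w hwX hwinj hwv hvw h01 h12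
      h23 (mem_facetNormals.1 hc'F).1 (mem_tightSet.1 hvc').2 (mem_tightSet.1 hw0c').2
      (mem_tightSet.1 hyc').2

end Summit.AtomisticToContinuum.Crystallization.Theorems
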